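import Summits.AtomisticToContinuum.HydrodynamicLimit.Theorems.TwoClocksEquilibriumFastWindowLDBirthT12GainRadialGrowth
import Summits.AtomisticToContinuum.HydrodynamicLimit.Theorems.TwoClocksEquilibriumFastWindowLDBirthT12EnergyAction
import HarnessLib

/-!
# (e-K₂) for GENERAL radial test functions, IV: the true gain term on `G ∘ ‖·‖` against its Lorentz limit in a
# general weight class — absolute error `O(m W(‖v‖))` — and the log-linear / quadratic-log classes of the
# `ℓ = 0` bootstrap (helpers `t12_gainTerm_radial_sub_lorentz_growth`, `t12_gainTerm_radial_sub_lorentz_logLinear`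
# of the line `birth`, crux `TwoClocks.EquilibriumFastWindowLD`, stmt-AtomisticToContinuum-14440; infrastructure
# (e-K₂), `ℓ = 0`, towards the registered analytic sub-goal `t12_logLinearPreimage_and_dipoleModulus`, plan §5)

Continuation of `…T12GainRadialGrowth` (slice representation under Gaussian growth; the weight class `W ≥ 1`
nondecreasing on `[0, ∞)` with `W(s + t) ≤ W(s)(1 + t)ⁿ`, `|G| ≤ m W` on `[0, ∞)`, `G` measurable) and of
`…T12GainRadialGeneralB`, whose one-dimensional comparison is redone here in the weight class by the SAME mechanism
and without any regularity of `G` (`S = ‖v‖`, `J(t) = ∫_{-1}^{1} (S x - t)₊ G(√(S² - (S x)² + t²)) dx`, `γ = gaussianReal 0 1`):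

* the speed shift (`abs_integral_speedShift_le_weight`): the substitution `y = S² - (Sx)² + t²`
  (`integral_mul_comp_slice_subst`) turns `∫₀¹ Sx G(√(S²(1 - x²) + t²)) dx` into `(2S)⁻¹ ∫_{t²}^{S² + t²} G(√y) dy`, an
  `O(t²)`-DISPLACEMENT of the window `[0, S²]` of the law of `‖v'‖²`, on which `|G(√y)| ≤ m W(S + |t|)`: cost
  `m W(S + |t|)(2 + t²)` (`S ≥ 1`; trivially for `S ≤ 1`); with the flux shift `2|t| m W(S + |t|)` of the sibling file,
  `|J(t) - J(0)| ≤ 2 m W(S + |t|)(1 + |t|)² ≤ 2 m W(S)(1 + |t|)ⁿ⁺²` (`abs_slice_sub_slice_zero_le_weight`) — the weight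
  is met at the DISPLACED radius `S + |t|` and brought back to `S` by the polynomial increment, the Gaussian tail of
  the thermal projection `t` absorbing `(1 + |t|)ⁿ⁺²`;
* the registered **`t12_gainTerm_radial_sub_lorentz_growth`** (`abs_gainTerm_radial_sub_lorentzGain_le_weight`):
  `|gainTerm (G ∘ ‖·‖) v - lorentzGain (G ∘ ‖·‖) v| ≤ 8π m W(‖v‖) M_{n+2}`, `M_k = ∫ (1 + |t|)ᵏ dγ` — ABSOLUTE error
  `O(m W(‖v‖))`, RELATIVE error `O(1/‖v‖)` against the main term `lorentzGain (G ∘ ‖·‖) v ≍ m ‖v‖ W(‖v‖)`, for all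
  classes at once;
* the two classes of the bootstrap (`logLinearWeight_class`, `quadLogWeight_class`, `M_4 ≤ 22`, `M_6 ≤ 176` of
  `…T12EnergyAction`): the registered **`t12_gainTerm_radial_sub_lorentz_logLinear`** —
  `|G t| ≤ m(1 + t)(1 + log(1 + t))` ⟹ error `≤ 176 π m (1 + ‖v‖)(1 + log(1 + ‖v‖))` — and
  **`abs_gainTerm_radial_sub_lorentzGain_le_quadLog`** — `|G t| ≤ m(1 + t²)(1 + log(1 + t²))` ⟹ error
  `≤ 1408 π m (1 + ‖v‖²)(1 + log(1 + ‖v‖²))` (relative `O(1/‖v‖)` against `≍ m‖v‖³ log ‖v‖`). For linear growth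
  (`n = 1`, `M_3 ≤ 9`) the general theorem gives `72π m(1 + ‖v‖)`, cf. the sharper `2π m(25 + 4‖v‖)` of
  `t12_gainTerm_radial_sub_lorentz`, which keeps the `S`-dependence of the flux shift separate.

The order `O(m W(‖v‖))` is honest for the rough class: a jump of `G` of the admissible size `m W(S)` at radius `S`
(an indicator, `t12_gainTerm_indicator_sub_lorentz`) already produces an error `≍ m W(S)`; for smooth `G` it is smaller
(`G = r²`: `gainTerm ‖·‖² v - π‖v‖³ = O(‖v‖)`, `abs_gainTerm_normSq_sub_lorentz` of `…T12EnergyAction`).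
[folklore] (Grad 1963 §4; Cercignani–Illner–Pulvirenti 1994 §7.2; (e-K₂) of the corrector-growth plan of the line `birth`).
-/

noncomputable section

open MeasureTheory ProbabilityTheory Real Set Filter Metric
open scoped ENNReal BigOperators InnerProductSpace
namespace Summit.AtomisticToContinuum.HydrodynamicLimit.Theorems.ClampedCorrectorBirth

open Literature.Analysis.FluidPDE Literature.MathematicalPhysics.KineticTheory
open Literature.Analysis.UnboundedOperators Literature.Probability.Distributions

variable {G W : ℝ → ℝ} {m : ℝ} {n : ℕ} {v : EuclideanSpace ℝ (Fin 3)}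

/-! ### The speed shift and the slice comparison in the weight class -/

section WeightClass

variable (hG : Measurable G)
  (hW : (∀ a b : ℝ, 0 ≤ a → a ≤ b → W a ≤ W b) ∧ (∀ a : ℝ, 0 ≤ a → 1 ≤ W a) ∧
    ∀ s t : ℝ, 0 ≤ s → 0 ≤ t → W (s + t) ≤ W s * (1 + t) ^ n)
  (hGw : ∀ t : ℝ, 0 ≤ t → |G t| ≤ m * W t)
include hG hW hGw

/-- **The speed shift** in the weight class: for `0 ≤ S` and every `t`,
`|∫_{-1}^{1} (S x)₊ (G(√(S² - (S x)² + t²)) - G(√(S² - (S x)²))) dx| ≤ m W(S + |t|) (2 + t²)`.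
For `S ≥ 1` the substitution `y = S² - (S x)² + t²` (`integral_mul_comp_slice_subst`) exhibits the difference as
`(2S)⁻¹ (∫_{S²}^{S² + t²} - ∫₀^{t²}) G(√y) dy`, two windows of length `t²` on which `|G(√y)| ≤ m W(S + |t|)`;
for `S ≤ 1` the trivial bound `2 S m W(S + |t|)` suffices. No regularity of `G` is involved. [folklore] -/
theorem abs_integral_speedShift_le_weight {S : ℝ} (hS : 0 ≤ S) (t : ℝ) :
    |∫ x in (-1:ℝ)..1, max (S * x) 0 * (G (√(S ^ 2 - (S * x) ^ 2 + t ^ 2)) - G (√(S ^ 2 - (S * x) ^ 2)))| ≤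
      m * W (S + |t|) * (2 + t ^ 2) := by
  have hm0 := nonneg_of_weightGrowth hW hGw
  have hWt : 0 ≤ W (S + |t|) := zero_le_one.trans (hW.2.1 _ (by positivity))
  have hGt : ∀ x, |G (√(S ^ 2 - (S * x) ^ 2 + t ^ 2))| ≤ m * W (S + |t|) := fun x =>
    (abs_comp_sqrt_le_weight hW hGw hS (S * x) t).1
  have hG0 : ∀ x, |G (√(S ^ 2 - (S * x) ^ 2))| ≤ m * W (S + |t|) := fun x => by
    have h := (abs_comp_sqrt_le_weight hW hGw hS (S * x) 0).1
    simp only [ne_eq, OfNat.ofNat_ne_zero, not_false_eq_true, zero_pow, add_zero, abs_zero] at h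
    exact h.trans (mul_le_mul_of_nonneg_left (hW.1 _ _ hS (by linarith [abs_nonneg t])) hm0)
  have hdiff : ∀ x, |G (√(S ^ 2 - (S * x) ^ 2 + t ^ 2)) - G (√(S ^ 2 - (S * x) ^ 2))| ≤
      m * W (S + |t|) + m * W (S + |t|) := fun x => (abs_sub _ _).trans (add_le_add (hGt x) (hG0 x))
  have hF : IntervalIntegrable (fun x => max (S * x) 0 *
      (G (√(S ^ 2 - (S * x) ^ 2 + t ^ 2)) - G (√(S ^ 2 - (S * x) ^ 2)))) volume (-1) 1 := by
    refine intervalIntegrable_of_abs_le (by fun_prop) (C := S * (m * W (S + |t|) + m * W (S + |t|))) fun x hx => ?_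
    rw [uIoc_of_le (by norm_num)] at hx
    rw [abs_mul, abs_of_nonneg (le_max_right _ _)]
    exact mul_le_mul (max_le (by nlinarith [hx.2]) hS) (hdiff x) (abs_nonneg _) hS
  rw [integral_posPart_mul_eq_integral_Icc hS hF]
  -- the trivial bound, used for `S ≤ 1`
  have hcrude : |∫ x in (0:ℝ)..1, S * x * (G (√(S ^ 2 - (S * x) ^ 2 + t ^ 2)) - G (√(S ^ 2 - (S * x) ^ 2)))| ≤
      S * (m * W (S + |t|) + m * W (S + |t|)) := by
    have h := intervalIntegral.norm_integral_le_of_norm_le_const (a := (0:ℝ)) (b := 1)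
      (C := S * (m * W (S + |t|) + m * W (S + |t|)))
      (f := fun x => S * x * (G (√(S ^ 2 - (S * x) ^ 2 + t ^ 2)) - G (√(S ^ 2 - (S * x) ^ 2)))) fun x hx => by
        rw [uIoc_of_le zero_le_one] at hx
        rw [Real.norm_eq_abs, abs_mul, abs_of_nonneg (by nlinarith [hx.1] : 0 ≤ S * x)]
        exact mul_le_mul (by nlinarith [hx.2]) (hdiff x) (abs_nonneg _) hS
    rw [Real.norm_eq_abs] at h
    simpa using h
  rcases le_total S 1 with hS1 | hS1
  · refine hcrude.trans ?_
    nlinarith [mul_nonneg (mul_nonneg hm0 hWt) (sq_nonneg t), mul_nonneg (mul_nonneg hm0 hWt) (sub_nonneg.2 hS1)]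
  -- `S ≥ 1`: the substitution
  have hS' : 0 < S := by linarith
  have i1 : IntervalIntegrable (fun x => S * x * G (√(S ^ 2 - (S * x) ^ 2 + t ^ 2))) volume 0 1 := by
    refine intervalIntegrable_of_abs_le (by fun_prop) (C := S * (m * W (S + |t|))) fun x hx => ?_
    rw [uIoc_of_le zero_le_one] at hx
    rw [abs_mul, abs_of_nonneg (by nlinarith [hx.1] : 0 ≤ S * x)]
    exact mul_le_mul (by nlinarith [hx.2]) (hGt x) (abs_nonneg _) hS
  have i2 : IntervalIntegrable (fun x => S * x * G (√(S ^ 2 - (S * x) ^ 2))) volume 0 1 := by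
    refine intervalIntegrable_of_abs_le (by fun_prop) (C := S * (m * W (S + |t|))) fun x hx => ?_
    rw [uIoc_of_le zero_le_one] at hx
    rw [abs_mul, abs_of_nonneg (by nlinarith [hx.1] : 0 ≤ S * x)]
    exact mul_le_mul (by nlinarith [hx.2]) (hG0 x) (abs_nonneg _) hS
  have e1 : ∫ x in (0:ℝ)..1, S * x * G (√(S ^ 2 - (S * x) ^ 2 + t ^ 2)) =
      (2 * S)⁻¹ * ∫ y in (t ^ 2)..(S ^ 2 + t ^ 2), G (√y) := by
    rw [← integral_mul_comp_slice_subst (fun y => G (√y)) hS' (t ^ 2), ← mul_assoc,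
      inv_mul_cancel₀ (by positivity), one_mul]
  have e2 : ∫ x in (0:ℝ)..1, S * x * G (√(S ^ 2 - (S * x) ^ 2)) = (2 * S)⁻¹ * ∫ y in (0:ℝ)..(S ^ 2), G (√y) := by
    have h := integral_mul_comp_slice_subst (fun y => G (√y)) hS' 0
    simp only [add_zero] at h
    rw [← h, ← mul_assoc, inv_mul_cancel₀ (by positivity), one_mul]
  have adj1 := intervalIntegral.integral_add_adjacent_intervals
    (intervalIntegrable_comp_sqrt_weight hW hGw hG 0 (t ^ 2))
    (intervalIntegrable_comp_sqrt_weight hW hGw hG (t ^ 2) (S ^ 2 + t ^ 2))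
  have adj2 := intervalIntegral.integral_add_adjacent_intervals
    (intervalIntegrable_comp_sqrt_weight hW hGw hG 0 (S ^ 2))
    (intervalIntegrable_comp_sqrt_weight hW hGw hG (S ^ 2) (S ^ 2 + t ^ 2))
  have hB : ∫ x in (0:ℝ)..1, S * x * (G (√(S ^ 2 - (S * x) ^ 2 + t ^ 2)) - G (√(S ^ 2 - (S * x) ^ 2))) =
      (2 * S)⁻¹ * ((∫ y in (S ^ 2)..(S ^ 2 + t ^ 2), G (√y)) - ∫ y in (0:ℝ)..(t ^ 2), G (√y)) := by
    simp_rw [mul_sub]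
    rw [intervalIntegral.integral_sub i1 i2, e1, e2]
    linear_combination (2 * S)⁻¹ * (adj1 - adj2)
  -- the two windows of length `t²`
  have window : ∀ a b : ℝ, 0 ≤ a → a ≤ b → √b ≤ S + |t| →
      |∫ y in a..b, G (√y)| ≤ m * W (S + |t|) * (b - a) := fun a b ha hab hb => by
    have h := intervalIntegral.norm_integral_le_of_norm_le_const (a := a) (b := b) (C := m * W (S + |t|))
      (f := fun y => G (√y)) fun y hy => by
        rw [uIoc_of_le hab] at hy
        rw [Real.norm_eq_abs]
        exact (hGw _ (sqrt_nonneg y)).trans (mul_le_mul_of_nonneg_left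
          (hW.1 _ _ (sqrt_nonneg y) ((Real.sqrt_le_sqrt hy.2).trans hb)) hm0)
    rwa [Real.norm_eq_abs, abs_of_nonneg (sub_nonneg.2 hab)] at h
  have w1 : |∫ y in (0:ℝ)..(t ^ 2), G (√y)| ≤ m * W (S + |t|) * (t ^ 2 - 0) :=
    window 0 (t ^ 2) le_rfl (sq_nonneg t) (by rw [Real.sqrt_sq_eq_abs]; linarith)
  have w2 : |∫ y in (S ^ 2)..(S ^ 2 + t ^ 2), G (√y)| ≤ m * W (S + |t|) * (S ^ 2 + t ^ 2 - S ^ 2) :=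
    window (S ^ 2) (S ^ 2 + t ^ 2) (sq_nonneg S) (by nlinarith) (by simpa using sqrt_sq_sub_sq_add_sq_le hS 0 t)
  rw [hB, abs_mul, abs_of_pos (by positivity : (0:ℝ) < (2 * S)⁻¹)]
  have habs : |(∫ y in (S ^ 2)..(S ^ 2 + t ^ 2), G (√y)) - ∫ y in (0:ℝ)..(t ^ 2), G (√y)| ≤
      m * W (S + |t|) * t ^ 2 + m * W (S + |t|) * t ^ 2 :=
    (abs_sub _ _).trans (add_le_add (w2.trans_eq (by ring)) (w1.trans_eq (by ring)))
  calc (2 * S)⁻¹ * |(∫ y in (S ^ 2)..(S ^ 2 + t ^ 2), G (√y)) - ∫ y in (0:ℝ)..(t ^ 2), G (√y)|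
      ≤ (2 * S)⁻¹ * (m * W (S + |t|) * t ^ 2 + m * W (S + |t|) * t ^ 2) :=
        mul_le_mul_of_nonneg_left habs (by positivity)
    _ = m * W (S + |t|) * t ^ 2 / S := by
        field_simp
        ring
    _ ≤ m * W (S + |t|) * t ^ 2 := div_le_self (by positivity) hS1
    _ ≤ m * W (S + |t|) * (2 + t ^ 2) := by nlinarith [mul_nonneg hm0 hWt]

/-- **The slice comparison, pointwise in the thermal projection**, in the weight class: for `0 ≤ S` and every `t`,
`|J(t) - J(0)| ≤ 2 m W(S + |t|) (1 + |t|)² ≤ 2 m W(S) (1 + |t|)ⁿ⁺²`, `J(t) = ∫_{-1}^{1} (S x - t)₊ G(√(S² - (S x)² + t²)) dx`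
(flux shift `2|t|` + speed shift `2 + t²`, then the polynomial increment of `W`). [folklore] -/
theorem abs_slice_sub_slice_zero_le_weight {S : ℝ} (hS : 0 ≤ S) (t : ℝ) :
    |(∫ x in (-1:ℝ)..1, max (S * x - t) 0 * G (√(S ^ 2 - (S * x) ^ 2 + t ^ 2))) -
        ∫ x in (-1:ℝ)..1, max (S * x) 0 * G (√(S ^ 2 - (S * x) ^ 2))| ≤ 2 * m * W (S + |t|) * (1 + |t|) ^ 2 ∧
      2 * m * W (S + |t|) * (1 + |t|) ^ 2 ≤ 2 * m * W S * (1 + |t|) ^ (n + 2) := by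
  have hm0 := nonneg_of_weightGrowth hW hGw
  have hWt : 0 ≤ W (S + |t|) := zero_le_one.trans (hW.2.1 _ (by positivity))
  have hGt : ∀ x, |G (√(S ^ 2 - (S * x) ^ 2 + t ^ 2))| ≤ m * W (S + |t|) := fun x =>
    (abs_comp_sqrt_le_weight hW hGw hS (S * x) t).1
  have hG0 : ∀ x, |G (√(S ^ 2 - (S * x) ^ 2))| ≤ m * W (S + |t|) := fun x => by
    have h := (abs_comp_sqrt_le_weight hW hGw hS (S * x) 0).1
    simp only [ne_eq, OfNat.ofNat_ne_zero, not_false_eq_true, zero_pow, add_zero, abs_zero] at h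
    exact h.trans (mul_le_mul_of_nonneg_left (hW.1 _ _ hS (by linarith [abs_nonneg t])) hm0)
  have hpos : ∀ x ∈ uIoc (-1:ℝ) 1, ∀ s : ℝ, max (S * x - s) 0 ≤ S + |s| := fun x hx s => by
    rw [uIoc_of_le (by norm_num)] at hx
    exact max_le (by nlinarith [hx.2, neg_abs_le s]) (by positivity)
  -- every integrand below is bounded by `K` on `(-1, 1]`
  set K : ℝ := (S + |t|) * (m * W (S + |t|) + m * W (S + |t|)) with hK
  have hK1 : ∀ x ∈ uIoc (-1:ℝ) 1, ∀ s ∈ ({t, 0} : Set ℝ), ∀ y : ℝ, |y| ≤ m * W (S + |t|) + m * W (S + |t|) →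
      |max (S * x - s) 0 * y| ≤ K := fun x hx s hs y hy => by
    rw [abs_mul, abs_of_nonneg (le_max_right _ _)]
    refine mul_le_mul ((hpos x hx s).trans ?_) hy (abs_nonneg _) (by positivity)
    rcases hs with rfl | rfl
    · exact le_rfl
    · simp [abs_nonneg]
  have hb1 : ∀ x, |G (√(S ^ 2 - (S * x) ^ 2 + t ^ 2))| ≤ m * W (S + |t|) + m * W (S + |t|) := fun x =>
    (hGt x).trans (le_add_of_nonneg_right (mul_nonneg hm0 hWt))
  have hb0 : ∀ x, |G (√(S ^ 2 - (S * x) ^ 2))| ≤ m * W (S + |t|) + m * W (S + |t|) := fun x =>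
    (hG0 x).trans (le_add_of_nonneg_right (mul_nonneg hm0 hWt))
  have hbd : ∀ x, |G (√(S ^ 2 - (S * x) ^ 2 + t ^ 2)) - G (√(S ^ 2 - (S * x) ^ 2))| ≤
      m * W (S + |t|) + m * W (S + |t|) := fun x => (abs_sub _ _).trans (add_le_add (hGt x) (hG0 x))
  have ik : IntervalIntegrable (fun x => max (S * x - t) 0 * G (√(S ^ 2 - (S * x) ^ 2 + t ^ 2))) volume (-1) 1 :=
    intervalIntegrable_of_abs_le (by fun_prop) fun x hx => hK1 x hx t (by simp) _ (hb1 x)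
  have ik0 : IntervalIntegrable (fun x => max (S * x) 0 * G (√(S ^ 2 - (S * x) ^ 2))) volume (-1) 1 :=
    intervalIntegrable_of_abs_le (by fun_prop) fun x hx => by simpa using hK1 x hx 0 (by simp) _ (hb0 x)
  have iQ : IntervalIntegrable (fun x => max (S * x) 0 *
      (G (√(S ^ 2 - (S * x) ^ 2 + t ^ 2)) - G (√(S ^ 2 - (S * x) ^ 2)))) volume (-1) 1 :=
    intervalIntegrable_of_abs_le (by fun_prop) fun x hx => by simpa using hK1 x hx 0 (by simp) _ (hbd x)
  have ik' : IntervalIntegrable (fun x => max (S * x) 0 * G (√(S ^ 2 - (S * x) ^ 2 + t ^ 2))) volume (-1) 1 :=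
    intervalIntegrable_of_abs_le (by fun_prop) fun x hx => by simpa using hK1 x hx 0 (by simp) _ (hb1 x)
  have hsplit : (∫ x in (-1:ℝ)..1, max (S * x - t) 0 * G (√(S ^ 2 - (S * x) ^ 2 + t ^ 2))) -
        (∫ x in (-1:ℝ)..1, max (S * x) 0 * G (√(S ^ 2 - (S * x) ^ 2))) =
      (∫ x in (-1:ℝ)..1, (max (S * x - t) 0 - max (S * x) 0) * G (√(S ^ 2 - (S * x) ^ 2 + t ^ 2))) +
        ∫ x in (-1:ℝ)..1, max (S * x) 0 * (G (√(S ^ 2 - (S * x) ^ 2 + t ^ 2)) - G (√(S ^ 2 - (S * x) ^ 2))) := by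
    rw [← intervalIntegral.integral_sub ik ik0, ← intervalIntegral.integral_add ((ik.sub ik').congr ?_) iQ]
    · refine intervalIntegral.integral_congr fun x _ => ?_
      ring
    · exact fun x _ => by ring
  refine ⟨?_, ?_⟩
  · rw [hsplit]
    calc _ ≤ |∫ x in (-1:ℝ)..1, (max (S * x - t) 0 - max (S * x) 0) * G (√(S ^ 2 - (S * x) ^ 2 + t ^ 2))| +
          |∫ x in (-1:ℝ)..1, max (S * x) 0 * (G (√(S ^ 2 - (S * x) ^ 2 + t ^ 2)) - G (√(S ^ 2 - (S * x) ^ 2)))| :=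
          abs_add_le _ _
      _ ≤ 2 * (|t| * (m * W (S + |t|))) + m * W (S + |t|) * (2 + t ^ 2) :=
          add_le_add (abs_integral_fluxShift_le_weight hW hGw hS t) (abs_integral_speedShift_le_weight hG hW hGw hS t)
      _ ≤ 2 * m * W (S + |t|) * (1 + |t|) ^ 2 := by
          have h2 : (1 + |t|) ^ 2 = 1 + 2 * |t| + t ^ 2 := by rw [← sq_abs t]; ring
          rw [h2]
          nlinarith [mul_nonneg (mul_nonneg hm0 hWt) (abs_nonneg t), mul_nonneg (mul_nonneg hm0 hWt) (sq_nonneg t)]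
  · have h := hW.2.2 S |t| hS (abs_nonneg t)
    calc 2 * m * W (S + |t|) * (1 + |t|) ^ 2 ≤ 2 * m * (W S * (1 + |t|) ^ n) * (1 + |t|) ^ 2 := by gcongr
      _ = 2 * m * W S * (1 + |t|) ^ (n + 2) := by ring

/-- **(e-K₂) on general radial test functions of the weight class**: for `G : ℝ → ℝ` measurable with
`|G t| ≤ m W(t)` on `[0, ∞)`, `W ≥ 1` nondecreasing with `W(s + t) ≤ W(s)(1 + t)ⁿ`, and every `v ∈ ℝ³`,
`|gainTerm (G ∘ ‖·‖) v - lorentzGain (G ∘ ‖·‖) v| ≤ 8π m W(‖v‖) ∫ (1 + |t|)ⁿ⁺² dγ(t)` — the slice form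
`4π ∫ γ(dt) (J(t) - J(0))` (`gainTerm_radial_eq_slice_gauss` via `gaussGrowth_of_weightGrowth`) and the pointwise
slice comparison. [folklore] -/
theorem abs_gainTerm_radial_sub_lorentzGain_le_weight (v : EuclideanSpace ℝ (Fin 3)) :
    |gainTerm (fun x => G ‖x‖) v - lorentzGain (fun x => G ‖x‖) v| ≤
      8 * π * m * W ‖v‖ * ∫ t, (1 + |t|) ^ (n + 2) ∂gaussianReal 0 1 := by
  have hg : Integrable (fun t : ℝ => 2 * m * W ‖v‖ * (1 + |t|) ^ (n + 2)) (gaussianReal 0 1) :=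
    (EnskogAdjointDuality.k2r_ref_integrable_one_add_abs_pow (n + 2)).const_mul _
  have hpt : ∀ t, |(∫ x in (-1:ℝ)..1, max (‖v‖ * x - t) 0 * G (√(‖v‖ ^ 2 - (‖v‖ * x) ^ 2 + t ^ 2))) -
      ∫ x in (-1:ℝ)..1, max (‖v‖ * x) 0 * G (√(‖v‖ ^ 2 - (‖v‖ * x) ^ 2))| ≤ 2 * m * W ‖v‖ * (1 + |t|) ^ (n + 2) :=
    fun t => (abs_slice_sub_slice_zero_le_weight hG hW hGw (norm_nonneg v) t).1.trans
      (abs_slice_sub_slice_zero_le_weight hG hW hGw (norm_nonneg v) t).2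
  rw [(gainTerm_radial_eq_slice_gauss hG (gaussGrowth_of_weightGrowth hW hGw) v).2, abs_mul,
    abs_of_pos (by positivity : (0:ℝ) < 4 * π)]
  calc 4 * π * |∫ t, ((∫ x in (-1:ℝ)..1, max (‖v‖ * x - t) 0 * G (√(‖v‖ ^ 2 - (‖v‖ * x) ^ 2 + t ^ 2))) -
        ∫ x in (-1:ℝ)..1, max (‖v‖ * x) 0 * G (√(‖v‖ ^ 2 - (‖v‖ * x) ^ 2))) ∂gaussianReal 0 1|
      ≤ 4 * π * ∫ t, 2 * m * W ‖v‖ * (1 + |t|) ^ (n + 2) ∂gaussianReal 0 1 := by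
        refine mul_le_mul_of_nonneg_left ?_ (by positivity)
        rw [← Real.norm_eq_abs]
        exact norm_integral_le_of_norm_le hg (Eventually.of_forall fun t => by rw [Real.norm_eq_abs]; exact hpt t)
    _ = 8 * π * m * W ‖v‖ * ∫ t, (1 + |t|) ^ (n + 2) ∂gaussianReal 0 1 := by rw [integral_const_mul]; ring

end WeightClass

/-! ### The two weight classes of the `ℓ = 0` bootstrap -/

/-- **(e-K₂) in the log-linear class**: `|G t| ≤ m (1 + t)(1 + log(1 + t))` on `[0, ∞)` ⟹
`|gainTerm (G ∘ ‖·‖) v - lorentzGain (G ∘ ‖·‖) v| ≤ 176 π m (1 + ‖v‖)(1 + log(1 + ‖v‖))` (`8 M_4 ≤ 176`). [folklore] -/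
theorem abs_gainTerm_radial_sub_lorentzGain_le_logLinear (hG : Measurable G)
    (hGw : ∀ t : ℝ, 0 ≤ t → |G t| ≤ m * (1 + t) * (1 + Real.log (1 + t))) (v : EuclideanSpace ℝ (Fin 3)) :
    |gainTerm (fun x => G ‖x‖) v - lorentzGain (fun x => G ‖x‖) v| ≤
      176 * π * m * (1 + ‖v‖) * (1 + Real.log (1 + ‖v‖)) := by
  have hW := logLinearWeight_class
  have hGw' : ∀ t : ℝ, 0 ≤ t → |G t| ≤ m * ((1 + t) * (1 + Real.log (1 + t))) :=
    fun t ht => (hGw t ht).trans_eq (by ring)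
  have h := abs_gainTerm_radial_sub_lorentzGain_le_weight (W := fun t => (1 + t) * (1 + Real.log (1 + t))) hG hW hGw' v
  have hm0 := nonneg_of_weightGrowth (W := fun t => (1 + t) * (1 + Real.log (1 + t))) hW hGw'
  have hW0 : 0 ≤ (1 + ‖v‖) * (1 + Real.log (1 + ‖v‖)) := zero_le_one.trans (hW.2.1 _ (norm_nonneg v))
  refine h.trans ?_
  have hM := integral_one_add_abs_pow_le.1
  calc 8 * π * m * ((1 + ‖v‖) * (1 + Real.log (1 + ‖v‖))) * ∫ t, (1 + |t|) ^ (2 + 2) ∂gaussianReal 0 1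
      ≤ 8 * π * m * ((1 + ‖v‖) * (1 + Real.log (1 + ‖v‖))) * 22 := mul_le_mul_of_nonneg_left hM (by positivity)
    _ = 176 * π * m * (1 + ‖v‖) * (1 + Real.log (1 + ‖v‖)) := by ring

/-- **(e-K₂) in the quadratic-log class**: `|G t| ≤ m (1 + t²)(1 + log(1 + t²))` on `[0, ∞)` ⟹
`|gainTerm (G ∘ ‖·‖) v - lorentzGain (G ∘ ‖·‖) v| ≤ 1408 π m (1 + ‖v‖²)(1 + log(1 + ‖v‖²))` (`8 M_6 ≤ 1408`) —
relative error `O(1/‖v‖)` against the main term `≍ m ‖v‖³ log ‖v‖`; the first round of the `ℓ = 0` bootstrap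
(a-priori growth of `t12_logQuadraticPreimage_of_quadraticData`). [folklore] -/
theorem abs_gainTerm_radial_sub_lorentzGain_le_quadLog (hG : Measurable G)
    (hGw : ∀ t : ℝ, 0 ≤ t → |G t| ≤ m * (1 + t ^ 2) * (1 + Real.log (1 + t ^ 2))) (v : EuclideanSpace ℝ (Fin 3)) :
    |gainTerm (fun x => G ‖x‖) v - lorentzGain (fun x => G ‖x‖) v| ≤
      1408 * π * m * (1 + ‖v‖ ^ 2) * (1 + Real.log (1 + ‖v‖ ^ 2)) := by
  have hW := quadLogWeight_class
  have hGw' : ∀ t : ℝ, 0 ≤ t → |G t| ≤ m * ((1 + t ^ 2) * (1 + Real.log (1 + t ^ 2))) :=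
    fun t ht => (hGw t ht).trans_eq (by ring)
  have h := abs_gainTerm_radial_sub_lorentzGain_le_weight
    (W := fun t => (1 + t ^ 2) * (1 + Real.log (1 + t ^ 2))) hG hW hGw' v
  have hm0 := nonneg_of_weightGrowth (W := fun t => (1 + t ^ 2) * (1 + Real.log (1 + t ^ 2))) hW hGw'
  have hW0 : 0 ≤ (1 + ‖v‖ ^ 2) * (1 + Real.log (1 + ‖v‖ ^ 2)) := zero_le_one.trans (hW.2.1 _ (norm_nonneg v))
  refine h.trans ?_
  have hM := integral_one_add_abs_pow_le.2
  calc 8 * π * m * ((1 + ‖v‖ ^ 2) * (1 + Real.log (1 + ‖v‖ ^ 2))) * ∫ t, (1 + |t|) ^ (4 + 2) ∂gaussianReal 0 1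
      ≤ 8 * π * m * ((1 + ‖v‖ ^ 2) * (1 + Real.log (1 + ‖v‖ ^ 2))) * 176 := mul_le_mul_of_nonneg_left hM (by positivity)
    _ = 1408 * π * m * (1 + ‖v‖ ^ 2) * (1 + Real.log (1 + ‖v‖ ^ 2)) := by ring

/-! ### Registered helpers -/

/-- **Registered helper `t12_gainTerm_radial_sub_lorentz_growth` — (e-K₂) for general radial test functions of
HIGHER GROWTH: the true gain term of the linearised hard-sphere operator on `G ∘ ‖·‖` against its far-field
(Lorentz) limit, for `G` merely measurable and dominated by a weight of the polynomial-increment class.**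
Data: `W : ℝ → ℝ` nondecreasing on `[0, ∞)` with `W ≥ 1` there and `W(s + t) ≤ W(s) (1 + t)ⁿ` (`s, t ≥ 0`; e.g.
`1 + t` (`n = 1`), `(1 + t)(1 + log(1 + t))` (`n = 2`), `(1 + t²)(1 + log(1 + t²))` (`n = 4`), `(1 + t)ᵏ` (`n = k`));
`G : ℝ → ℝ` measurable with `|G t| ≤ m W(t)` for `t ≥ 0` (no continuity, no bounded variation). Then for every
`v ∈ ℝ³` (`M = stdGaussian`, `σ` the surface measure of `S²`, `(v', w') = collide ω (v, w)`, `E_v = Lambert.embed (‖v‖⁻¹ v)`,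
`p ∈ ℝ²` Lebesgue on the unit disc, `γ = gaussianReal 0 1`):
`|∫ dM(w) ∫_{S²} ((v-w)·ω)₊ G(‖v'‖) dσ + ∫ dM(w) ∫_{S²} ((v-w)·ω)₊ G(‖w'‖) dσ`
` - ‖v‖ (∫_{‖p‖<1} G(‖‖p‖² v - ‖v‖√(1-‖p‖²) E_v p‖) dp + ∫_{‖p‖<1} G(‖(1-‖p‖²) v + ‖v‖√(1-‖p‖²) E_v p‖) dp)|`
` ≤ 8π m W(‖v‖) ∫ (1 + |t|)ⁿ⁺² dγ(t)`,
i.e. `|gainTerm (G ∘ ‖·‖) v - lorentzGain (G ∘ ‖·‖) v| ≤ 8π M_{n+2} · m W(‖v‖)`, `M_k = ∫ (1 + |t|)ᵏ dγ` (`M_4 ≤ 22`,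
`M_6 ≤ 176`: `integral_one_add_abs_pow_le`) — ABSOLUTE error `O(m W(‖v‖))`, RELATIVE error `O(1/‖v‖)` against the main
term `lorentzGain (G ∘ ‖·‖) v = π‖v‖ · 2∫₀¹ 2ρ G(ρ‖v‖) dρ ≍ m ‖v‖ W(‖v‖)`: the order each round of the `ℓ = 0` bootstrap
consumes. Mechanism: the slice form `gainTerm - lorentzGain = 4π ∫ γ(dt)(J(t) - J(0))`,
`J(t) = ∫_{-1}^{1} (Sx - t)₊ G(√(S² - (Sx)² + t²)) dx`, `S = ‖v‖` (`t12_gainTerm_radial_slice_gauss`, the weight class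
having Gaussian growth); the flux shift `|(Sx - t)₊ - (Sx)₊| ≤ |t|` costs `2|t| m W(S + |t|)`; the speed shift — the
substitution `y = S² - (Sx)² + t²`, an `O(t²)`-DISPLACEMENT of the window `[0, S²]` of the law of `‖v'‖²` — costs
`m W(S + |t|)(2 + t²)`; so `|J(t) - J(0)| ≤ 2 m W(S + |t|)(1 + |t|)² ≤ 2 m W(S)(1 + |t|)ⁿ⁺²`, the displaced radius
`S + |t|` being brought back to `S` by the polynomial increment against the Gaussian tail of `t`. [folklore] -/
theorem t12_gainTerm_radial_sub_lorentz_growth : ∀ (G W : ℝ → ℝ) (m : ℝ) (n : ℕ), Measurable G → (∀ a b : ℝ, 0 ≤ a → a ≤ b → W a ≤ W b) → (∀ a : ℝ, 0 ≤ a → 1 ≤ W a) → (∀ s t : ℝ, 0 ≤ s → 0 ≤ t → W (s + t) ≤ W s * (1 + t) ^ n) → (∀ t : ℝ, 0 ≤ t → |G t| ≤ m * W t) → ∀ v : EuclideanSpace ℝ (Fin 3), |(∫ w, ∫ ω, Literature.MathematicalPhysics.KineticTheory.hardSphereKernel (v, w) ω * G ‖(Literature.MathematicalPhysics.KineticTheory.collide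 ω (v, w)).1‖ ∂Literature.MathematicalPhysics.KineticTheory.sphereMeasure ∂ProbabilityTheory.stdGaussian (EuclideanSpace ℝ (Fin 3))) + (∫ w, ∫ ω, Literature.MathematicalPhysics.KineticTheory.hardSphereKernel (v, w) ω * G ‖(Literature.MathematicalPhysics.KineticTheory.collide ω (v, w)).2‖ ∂Literature.MathematicalPhysics.KineticTheory.sphereMeasure ∂ProbabilityTheory.stdGaussian (EuclideanSpace ℝ (Fin 3))) - ‖v‖ * ((∫ p in Metric.ball (0 : EuclideanSpace ℝ (Fin 2)) 1, G ‖(‖p‖ ^ 2) • v - (‖v‖ * Real.sqrt (1 - ‖p‖ ^ 2)) • Literature.Analysis.FluidPDE.Lambert.embed (‖v‖⁻¹ • v) p‖) + ∫ p in Metric.ball (0 : EuclideanSpace ℝ (Fin 2)) 1, G ‖(1 - ‖p‖ ^ 2) • v + (‖v‖ * Real.sqrt (1 - ‖p‖ ^ 2)) • Literature.Analysis.FluidPDE.Lambert.embed (‖v‖⁻¹ • v) p‖)| ≤ 8 * Real.pi * m * W ‖v‖ * ∫ t, (1 + |t|) ^ (n + 2) ∂ProbabilityTheory.gaussianReal 0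 1 :=
  fun _ _ _ _ hG hmono hone hsub hGw v => abs_gainTerm_radial_sub_lorentzGain_le_weight hG ⟨hmono, hone, hsub⟩ hGw v

/-- **Registered helper `t12_gainTerm_radial_sub_lorentz_logLinear` — (e-K₂) in the log-linear class, the second
round of the `ℓ = 0` bootstrap.** For `G : ℝ → ℝ` measurable with `|G t| ≤ m (1 + t)(1 + log(1 + t))` for `t ≥ 0` and
every `v ∈ ℝ³` (notation as in `t12_gainTerm_radial_sub_lorentz_growth`):
`|∫ dM(w) ∫_{S²} ((v-w)·ω)₊ G(‖v'‖) dσ + ∫ dM(w) ∫_{S²} ((v-w)·ω)₊ G(‖w'‖) dσ`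
` - ‖v‖ (∫_{‖p‖<1} G(‖‖p‖² v - ‖v‖√(1-‖p‖²) E_v p‖) dp + ∫_{‖p‖<1} G(‖(1-‖p‖²) v + ‖v‖√(1-‖p‖²) E_v p‖) dp)|`
` ≤ 176 π m (1 + ‖v‖)(1 + log(1 + ‖v‖))`,
i.e. `|gainTerm (G ∘ ‖·‖) v - lorentzGain (G ∘ ‖·‖) v| ≤ 176 π m W(‖v‖)`, `W(t) = (1 + t)(1 + log(1 + t))` — the
general theorem with `n = 2` (`logLinearWeight_class`: `W(s + t) ≤ W(s)(1 + t)²`) and `8 M_4 ≤ 176`. The quadratic-log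
class (first round, `n = 4`, constant `1408 π`) is `abs_gainTerm_radial_sub_lorentzGain_le_quadLog`. [folklore] -/
theorem t12_gainTerm_radial_sub_lorentz_logLinear : ∀ (G : ℝ → ℝ) (m : ℝ), Measurable G → (∀ t : ℝ, 0 ≤ t → |G t| ≤ m * (1 + t) * (1 + Real.log (1 + t))) → ∀ v : EuclideanSpace ℝ (Fin 3), |(∫ w, ∫ ω, Literature.MathematicalPhysics.KineticTheory.hardSphereKernel (v, w) ω * G ‖(Literature.MathematicalPhysics.KineticTheory.collide ω (v, w)).1‖ ∂Literature.MathematicalPhysics.KineticTheory.sphereMeasure ∂ProbabilityTheory.stdGaussian (EuclideanSpace ℝ (Fin 3))) + (∫ w, ∫ ω, Literature.MathematicalPhysics.KineticTheory.hardSphereKernel (v, w) ω * G ‖(Literature.MathematicalPhysics.KineticTheory.collide ω (v, w)).2‖ ∂Literature.MathematicalPhysics.KineticTheory.sphereMeasure ∂ProbabilityTheory.stdGaussian (EuclideanSpace ℝ (Fin 3))) - ‖v‖ * ((∫ p in Metric.ball (0 : EuclideanSpace ℝ (Fin 2)) 1, G ‖(‖p‖ ^ 2) • v - (‖v‖ *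 Real.sqrt (1 - ‖p‖ ^ 2)) • Literature.Analysis.FluidPDE.Lambert.embed (‖v‖⁻¹ • v) p‖) + ∫ p in Metric.ball (0 : EuclideanSpace ℝ (Fin 2)) 1, G ‖(1 - ‖p‖ ^ 2) • v + (‖v‖ * Real.sqrt (1 - ‖p‖ ^ 2)) • Literature.Analysis.FluidPDE.Lambert.embed (‖v‖⁻¹ • v) p‖)| ≤ 176 * Real.pi * m * (1 + ‖v‖) * (1 + Real.log (1 + ‖v‖)) :=
  fun _ _ hG hGw v => abs_gainTerm_radial_sub_lorentzGain_le_logLinear hG hGw v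

end Summit.AtomisticToContinuum.HydrodynamicLimit.Theorems.ClampedCorrectorBirth

end
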